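import Literature.Probability.RandomPlanarGeometry.LoewnerCurveLimit
import Literature.Probability.RandomPlanarGeometry.SimpleCurveLoewner
import Literature.Probability.RandomPlanarGeometry.ChordalBoundary
import HarnessLib

/-!
# Limits of simple chordal curves in a Dobrushin domain are described by the Loewner evolution

Topic `Literature/Probability/RandomPlanarGeometry` (family `crit-ising`); theorems only, no
definition and no named fact. The Dobrushin-domain form of Kemppainen–Smirnov's main lemma
(Ann. Probab. 45 (2017), App. A, Lemma A.4; `LoewnerCurveLimit.lean` proves its half-plane
form `exists_capacity_parametrisation_of_limit`): the pathwise statement behind "a.s. the limit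
curve can be fully described by the Loewner evolution, and the driving processes converge"
(KS Thm. 1.5 / Cor. 1.7; Chelkak–Duminil-Copin–Hongler–Kemppainen–Smirnov, C. R. Math. 352
(2014), Thm. 3) for ONE convergent sequence of curves and driving functions in a FIXED
Dobrushin domain `(D; a, b)` with chordal uniformizing map `φ : ℍ → D`.

* `MarkedDomain.IsChordalUniformizing.exists_inverse_boundaryExtension` — the inverse boundary
  correspondence `ψ : closure D ∖ {b} → ℍ̄` of the boundary extension `Φ` of `φ`
  (Carathéodory's theorem in the tree's disc form, `JordanDomain.IsDiscExtension`,
  `ChordalBoundary.lean`): continuous, `Φ ∘ ψ = id` on `closure D ∖ {b}`, `ψ ∘ Φ = id` on `ℍ̄`,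
  `ψ = φ⁻¹` on `D`, `ψ a = 0`; and `tendsto_boundaryExtension_cocompact` (`Φ z → b` as
  `z → ∞` in `ℍ̄`);
* `MarkedDomain.IsChordalUniformizing.tendstoUniformlyOn_pullback` — if parametrised curves
  `c_n → c` uniformly and `c[0, s₀]` avoids `b`, the pull-backs `ψ ∘ c_n → ψ ∘ c` uniformly
  on `[0, s₀]` (uniform continuity of `ψ` on the compact `closure D ∖ B(b, ρ)`);
* **`MarkedDomain.IsChordalUniformizing.exists_isLoewnerDescribed_of_limit`** — let
  `c_n : [0, 1] → ℂ` be simple chordal curves in `(D; a, b)` (interior in `D`, entering `b`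
  with diverging capacity) converging uniformly, as parametrised curves, to `c` with `c 0 = a`,
  `c 1 = b`, `c[0, 1) ⊆ closure D ∖ {b}` (boundary contact allowed); suppose their Loewner
  transforms `drivingFunction φ (c_n) → W` locally uniformly (`W` continuous), and that the
  capacity of the pull-back of `c[0, s]` grows strictly and diverges (the hypotheses of the
  half-plane lemma, stated for the pull-back `η` characterised by `Φ ∘ η = c`, `im η ≥ 0`).
  Then **the class of `c` is described through `φ` by `W`** (`IsLoewnerDescribed φ ⟦c⟧ W`),
  `W 0 = 0`, and the capacity parametrisations converge: the traces of the `c_n`-chains tend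
  locally uniformly to a curve generating the chain of `W` whose `Φ`-image is `c`; the variant
  `exists_isLoewnerDescribed_of_limit_of_im` reads the divergence of the capacity off the
  unboundedness of `im η`; the common half-plane data are `exists_limit_pullback_data`;
* `exists_reparam_tendstoUniformly`, `exists_isLoewnerDescribed_of_tendsto_mk` — the same with
  the uniform convergence of parametrised curves replaced by the convergence `⟦c_n⟧ → ⟦c⟧` of
  curve classes (the topology of the laws of random curves).

## References

* A. Kemppainen, S. Smirnov, Ann. Probab. 45 (2017), Thm. 1.5, Cor. 1.7, App. A Lemma A.4
  (arXiv:1212.6215: Thm. 1.3, Cor. 1.5, Lemma 5.5). [KemppainenSmirnov2017]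
* D. Chelkak, H. Duminil-Copin, C. Hongler, A. Kemppainen, S. Smirnov, C. R. Math. Acad. Sci.
  Paris 352 (2014) 157–161, Thm. 3 and p. 4. [CDHKSCRAS2014]
* Ch. Pommerenke, *Boundary Behaviour of Conformal Maps* (1992), Thm. 2.6. [PommerenkeBBCM1992]
-/

noncomputable section

open Set Filter Metric Bornology Function
open _root_.Topology
open UpperHalfPlane (upperHalfPlaneSet isOpen_upperHalfPlaneSet)
open scoped NNReal unitInterval

namespace Literature.Probability.RandomPlanarGeometry

namespace MarkedDomain.IsChordalUniformizing

variable {D : DobrushinDomain} {φ : ConformalEquiv upperHalfPlaneSet D.carrier}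

/-! ### The inverse boundary correspondence -/

/-- **`Φ z → b` as `z → ∞` in the closed half-plane**, for the boundary extension `Φ` of a
chordal uniformizing map of `(D; a, b)` (`Φ = Φ_𝔻 ∘ cayley` with the Carathéodory disc
extension `Φ_𝔻`, continuous at `1 = cayley(∞)`). [cite: PommerenkeBBCM1992, Thm. 2.6] -/
theorem tendsto_boundaryExtension_cocompact (hφ : D.IsChordalUniformizing φ) :
    Tendsto φ.boundaryExtension (cocompact ℂ ⊓ 𝓟 {z : ℂ | 0 ≤ z.im}) (𝓝 (D.pt 1)) := by
  obtain ⟨Φ, hΦ⟩ := JordanDomain.exists_isDiscExtension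
    JordanDomain.exists_continuousOn_extension_holds φ
  have hb : Φ 1 = D.pt 1 := hΦ.apply_one_eq hφ.2
  have h1 : Tendsto cayleyFun (cocompact ℂ ⊓ 𝓟 {z : ℂ | 0 ≤ z.im}) (𝓝[closedBall 0 1] 1) := by
    refine tendsto_nhdsWithin_iff.2 ⟨tendsto_cayleyFun_cocompact.mono_left inf_le_left, ?_⟩
    filter_upwards [mem_inf_of_right (mem_principal_self _)] with z hz
    exact mem_closedBall_zero_iff.2 (norm_cayleyFun_le_one hz)
  have h2 : Tendsto Φ (𝓝[closedBall 0 1] 1) (𝓝 (Φ 1)) :=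
    hΦ.continuousOn.continuousWithinAt (mem_closedBall_zero_iff.2 (by simp))
  rw [← hb]
  refine (h2.comp h1).congr' ?_
  filter_upwards [mem_inf_of_right (mem_principal_self _)] with z hz
  exact (hΦ.boundaryExtension_eq hz).symm

/-- **The inverse boundary correspondence of a chordal uniformizing map.** For a chordal
uniformizing map `φ` of `(D; a, b)` with boundary extension `Φ : ℍ̄ → closure D` there is
`ψ : ℂ → ℂ` with: `ψ` continuous on `closure D ∖ {b}`; `im ψ ≥ 0` and `Φ (ψ p) = p` there;
`ψ (Φ z) = z` for `im z ≥ 0`; `ψ = φ⁻¹` on `D`; `ψ a = 0`. (Carathéodory: the disc extension is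
a continuous bijection of the compact closed disc onto `closure D`, so its inverse is
continuous; the Cayley transform is continuous off `1`, the preimage of `b`.)
[cite: PommerenkeBBCM1992, Thm. 2.6] -/
theorem exists_inverse_boundaryExtension (hφ : D.IsChordalUniformizing φ) :
    ∃ ψ : ℂ → ℂ, ContinuousOn ψ (closure D.carrier \ {D.pt 1}) ∧
      (∀ p ∈ closure D.carrier \ {D.pt 1}, 0 ≤ (ψ p).im ∧ φ.boundaryExtension (ψ p) = p) ∧
      (∀ z : ℂ, 0 ≤ z.im → ψ (φ.boundaryExtension z) = z) ∧
      (∀ p ∈ D.carrier, ψ p = φ.symm p) ∧ ψ (D.pt 0) = 0 := by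
  obtain ⟨Φ, hΦ⟩ := JordanDomain.exists_isDiscExtension
    JordanDomain.exists_continuousOn_extension_holds φ
  have hb : Φ 1 = D.pt 1 := hΦ.apply_one_eq hφ.2
  set g : ℂ → ℂ := invFunOn Φ (closedBall 0 1) with hg
  set ψ : ℂ → ℂ := fun p ↦ cayleyInvFun (g p) with hψ
  have hinv : InvOn g Φ (closedBall 0 1) (closure D.carrier) := hΦ.bijOn.invOn_invFunOn
  have hgmem : ∀ p ∈ closure D.carrier, g p ∈ closedBall (0 : ℂ) 1 := fun p hp ↦
    invFunOn_mem (hΦ.bijOn.surjOn hp)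
  have hgΦ : ∀ p ∈ closure D.carrier, Φ (g p) = p := fun p hp ↦ hinv.2 hp
  have hgne : ∀ p ∈ closure D.carrier \ {D.pt 1}, g p ≠ 1 := by
    rintro p ⟨hp, hpb⟩ h1
    apply hpb
    rw [mem_singleton_iff, ← hb, ← h1, hgΦ p hp]
  -- `ψ ∘ Φ_H = id` on the closed half-plane
  have hleft : ∀ z : ℂ, 0 ≤ z.im → ψ (φ.boundaryExtension z) = z := by
    intro z hz
    simp only [hψ, hg]
    rw [hΦ.boundaryExtension_eq hz, hΦ.bijOn.injOn.leftInvOn_invFunOn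
      (mem_closedBall_zero_iff.2 (norm_cayleyFun_le_one hz)),
      cayleyInvFun_cayleyFun (add_I_ne_zero hz)]
  refine ⟨ψ, ?_, ?_, hleft, ?_, ?_⟩
  · -- continuity
    have h1 : ContinuousOn g (closure D.carrier) := by
      rw [hg, ← hΦ.bijOn.image_eq]
      exact IsCompact.continuousOn_invFunOn (isCompact_closedBall 0 1) hΦ.continuousOn
        hΦ.bijOn.injOn
    exact differentiableOn_cayleyInvFun.continuousOn.comp (h1.mono sdiff_subset) fun p hp ↦ hgne p hp
  · rintro p ⟨hp, hpb⟩
    have hw := hgmem p hp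
    have hw1 : g p ≠ 1 := hgne p ⟨hp, hpb⟩
    have him : 0 ≤ (ψ p).im := by
      simp only [hψ]
      rw [cayleyInvFun_im]
      refine div_nonneg ?_ (Complex.normSq_nonneg _)
      have : Complex.normSq (g p) ≤ 1 := by
        rw [Complex.normSq_eq_norm_sq]
        have h := mem_closedBall_zero_iff.1 hw
        nlinarith [norm_nonneg (g p)]
      linarith
    refine ⟨him, ?_⟩
    rw [hΦ.boundaryExtension_eq him]
    simp only [hψ]
    rw [cayleyFun_cayleyInvFun hw1, hgΦ p hp]
  · intro p hp
    have hz : 0 < (φ.symm p).im := φ.symm_mapsTo hp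
    have h := hleft (φ.symm p) hz.le
    rwa [φ.boundaryExtension_eq (φ.symm_mapsTo hp), φ.apply_symm_apply hp] at h
  · have h := hleft 0 (by simp)
    rwa [φ.boundaryExtension_eq_of_hasBoundaryValue (mem_closure_upperHalfPlaneSet_iff.2 (by simp))
      hφ.1] at h

/-! ### Pull-backs of uniformly convergent curves converge uniformly -/

/-- **Uniform convergence of the pull-backs.** Let `ψ` be continuous on `closure D ∖ {b}`, let
parametrised curves `c_n → c` uniformly with values in `closure D`, and let `c[0, s₀]` avoid
`b`. Then `ψ ∘ c_n → ψ ∘ c` uniformly on `[0, s₀]` (as functions of the real parameter,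
through `IccExtend`): `c[0, s₀]` is at distance `ρ > 0` from `b`, the `c_n[0, s₀]` eventually
lie in the compact set `closure D ∖ B(b, ρ/2)`, on which `ψ` is uniformly continuous.
[folklore] -/
theorem tendstoUniformlyOn_pullback {ψ : ℂ → ℂ}
    (hψc : ContinuousOn ψ (closure D.carrier \ {D.pt 1})) {cn : ℕ → Curve ℂ} {c : Curve ℂ}
    (hlim : TendstoUniformly (fun n (s : I) ↦ cn n s) c atTop)
    (hcln : ∀ n (s : I), cn n s ∈ closure D.carrier) (hcl : ∀ s : I, c s ∈ closure D.carrier)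
    {s₀ : ℝ} (hb : ∀ s : I, (s : ℝ) ≤ s₀ → c s ≠ D.pt 1) :
    TendstoUniformlyOn (fun n u ↦ ψ (IccExtend zero_le_one (cn n) u))
      (fun u ↦ ψ (IccExtend zero_le_one c u)) atTop (Icc 0 s₀) := by
  rcases lt_or_ge s₀ 0 with hs₀ | hs₀
  · rw [Icc_eq_empty (not_le.2 hs₀)]
    exact tendstoUniformlyOn_empty
  -- the compact set `K = c {s ≤ s₀}` and its distance `ρ` to `b`
  set K : Set ℂ := c '' {s : I | (s : ℝ) ≤ s₀} with hK
  have hKc : IsCompact K :=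
    ((isClosed_le continuous_subtype_val continuous_const).isCompact).image c.continuous
  have hKne : K.Nonempty := ⟨c 0, ⟨0, by simpa using hs₀, rfl⟩⟩
  have hbK : D.pt 1 ∉ K := by
    rintro ⟨s, hs, hsb⟩
    exact hb s hs hsb
  set ρ : ℝ := infDist (D.pt 1) K with hρ
  have hρ0 : 0 < ρ := (hKc.isClosed.notMem_iff_infDist_pos hKne).1 hbK
  have hρK : ∀ p ∈ K, ρ ≤ dist (D.pt 1) p := fun p hp ↦ infDist_le_dist_of_mem hp
  -- the compact set `L = closure D ∖ B(b, ρ/2)`, on which `ψ` is uniformly continuous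
  set L : Set ℂ := closure D.carrier ∩ (ball (D.pt 1) (ρ / 2))ᶜ with hL
  have hLc : IsCompact L := D.isBounded.isCompact_closure.inter_right isOpen_ball.isClosed_compl
  have hLsub : L ⊆ closure D.carrier \ {D.pt 1} := by
    rintro p ⟨hp, hpb⟩
    refine ⟨hp, fun h ↦ hpb ?_⟩
    rw [mem_singleton_iff] at h
    rw [h]
    exact mem_ball_self (half_pos hρ0)
  have hKL : K ⊆ L := fun p hp ↦ ⟨by obtain ⟨s, -, rfl⟩ := hp; exact hcl s, fun h ↦ by
    have h1 := hρK p hp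
    rw [mem_ball, dist_comm] at h
    linarith⟩
  rw [Metric.tendstoUniformlyOn_iff]
  intro ε hε
  obtain ⟨δ, hδ, hU⟩ := Metric.uniformContinuousOn_iff.1
    (hLc.uniformContinuousOn_of_continuous (hψc.mono hLsub)) ε hε
  -- the parameters `≤ s₀` are sent into `K` by `c` and eventually `δ`-close by `c_n`
  have hproj : ∀ u ∈ Icc 0 s₀, ((projIcc (0 : ℝ) 1 zero_le_one u : I) : ℝ) ≤ s₀ := by
    intro u hu
    rw [coe_projIcc]
    exact max_le hs₀ ((min_le_right _ _).trans hu.2)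
  filter_upwards [(Metric.tendstoUniformly_iff.1 hlim) (min δ (ρ / 2)) (lt_min hδ (half_pos hρ0))]
    with n hn u hu
  set t : I := projIcc (0 : ℝ) 1 zero_le_one u with ht
  have hct : IccExtend zero_le_one c u = c t := rfl
  have hcnt : IccExtend zero_le_one (cn n) u = cn n t := rfl
  rw [hct, hcnt]
  have htK : c t ∈ K := ⟨t, hproj u hu, rfl⟩
  have h1 := hn t
  have hδ' : dist (c t) (cn n t) < δ := h1.trans_le (min_le_left _ _)
  have hρ' : dist (c t) (cn n t) < ρ / 2 := h1.trans_le (min_le_right _ _)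
  have hnL : cn n t ∈ L := by
    refine ⟨hcln n t, fun h ↦ ?_⟩
    rw [mem_ball] at h
    have h2 := hρK _ htK
    have h3 : dist (D.pt 1) (c t) ≤ dist (D.pt 1) (cn n t) + dist (cn n t) (c t) := dist_triangle _ _ _
    rw [dist_comm (cn n t) (c t)] at h3
    rw [dist_comm] at h
    linarith
  exact hU (c t) (hKL htK) (cn n t) hnL hδ'

/-! ### Limits of simple chordal curves are described by the Loewner evolution -/

/-- **The half-plane data of a convergent sequence of simple chordal curves.** For simple
chordal curves `c_n` of `(D; a, b)` converging uniformly (as parametrised curves) to `c` with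
`c[0, 1) ⊆ closure D ∖ {b}`: the pull-backs `η_n = ψ ∘ c_n`, `η = ψ ∘ c` by the inverse
boundary correspondence `ψ` (`exists_inverse_boundaryExtension`) — `η` continuous on `[0, 1)`
with `im η ≥ 0`, `Φ ∘ η = c`, `im η 0 = 0`; `im η_n ≥ 0`; `η_n → η` uniformly on every `[0, s]`
(`tendstoUniformlyOn_pullback`) — and the capacity clocks `θ_n` of the `c_n`
(`exists_isLoewnerDescribed_of_injOn`), for which the traces of the Loewner transforms
`W_n = drivingFunction φ ⟦c_n⟧` are capacity parametrisations: `trace W_n (θ_n u) = η_n u`.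
[cite: KemppainenSmirnov2017, App. A Lemma A.4] -/
theorem exists_limit_pullback_data (hφ : D.IsChordalUniformizing φ)
    {cn : ℕ → Curve ℂ} {c : Curve ℂ}
    (h0n : ∀ n, cn n 0 = D.pt 0) (h1n : ∀ n, cn n 1 = D.pt 1)
    (hinn : ∀ n (s : I), 0 < (s : ℝ) → (s : ℝ) < 1 → cn n s ∈ D.carrier)
    (hinjn : ∀ n, InjOn (cn n) {s : I | 0 < (s : ℝ) ∧ (s : ℝ) < 1})
    (hinfn : ∀ n, Tendsto (fun u : ℝ ↦ (φ.symm (IccExtend zero_le_one (cn n) u)).im)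
      (𝓝[<] 1) atTop)
    (h0 : c 0 = D.pt 0)
    (hcl : ∀ s : I, (s : ℝ) < 1 → c s ∈ closure D.carrier ∧ c s ≠ D.pt 1)
    (hlim : TendstoUniformly (fun n (s : I) ↦ cn n s) c atTop) :
    ∃ (η : ℝ → ℂ) (ηn : ℕ → ℝ → ℂ) (θn : ℕ → ℝ → ℝ≥0),
      (∀ u ∈ Ico (0 : ℝ) 1, 0 ≤ (η u).im ∧ φ.boundaryExtension (η u) = IccExtend zero_le_one c u) ∧
      ContinuousOn η (Ico 0 1) ∧ (η 0).im = 0 ∧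
      (∀ n, ∀ u ∈ Ico (0 : ℝ) 1, 0 ≤ (ηn n u).im) ∧
      (∀ s, s < 1 → TendstoUniformlyOn ηn η atTop (Icc 0 s)) ∧
      (∀ n, ContinuousOn (θn n) (Ico 0 1)) ∧ (∀ n, StrictMonoOn (θn n) (Ico 0 1)) ∧
      (∀ n, θn n 0 = 0) ∧ (∀ n, Tendsto (θn n) (𝓝[<] 1) atTop) ∧
      (∀ n, ∀ u ∈ Ico (0 : ℝ) 1,
        Loewner.trace (drivingFunction φ (CurveClass.mk (cn n))) (θn n u) = ηn n u) ∧
      (∀ n, Continuous (drivingFunction φ (CurveClass.mk (cn n)))) ∧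
      (∀ n, Loewner.IsGeneratedByCurve (drivingFunction φ (CurveClass.mk (cn n)))
        (Loewner.trace (drivingFunction φ (CurveClass.mk (cn n))))) := by
  -- the inverse boundary correspondence `ψ` and the pull-backs
  obtain ⟨ψ, hψc, hψΦ, -, hψsymm, hψa⟩ := hφ.exists_inverse_boundaryExtension
  set ηn : ℕ → ℝ → ℂ := fun n u ↦ ψ (IccExtend zero_le_one (cn n) u) with hηn
  set η : ℝ → ℂ := fun u ↦ ψ (IccExtend zero_le_one c u) with hη
  have hext : ∀ (f : Curve ℂ) {u : ℝ} (hu : u ∈ Ico (0 : ℝ) 1),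
      IccExtend zero_le_one f u = f ⟨u, hu.1, hu.2.le⟩ := fun f u hu ↦
    IccExtend_of_mem zero_le_one f ⟨hu.1, hu.2.le⟩
  -- the limit
  have hcmem : ∀ {u : ℝ} (hu : u ∈ Ico (0 : ℝ) 1),
      IccExtend zero_le_one c u ∈ closure D.carrier \ {D.pt 1} := by
    intro u hu
    rw [hext c hu]
    exact ⟨(hcl _ hu.2).1, (hcl _ hu.2).2⟩
  have hηchar : ∀ u ∈ Ico (0 : ℝ) 1,
      0 ≤ (η u).im ∧ φ.boundaryExtension (η u) = IccExtend zero_le_one c u :=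
    fun u hu ↦ hψΦ _ (hcmem hu)
  have hηc : ContinuousOn η (Ico 0 1) :=
    hψc.comp (c.continuous.Icc_extend' (h := zero_le_one)).continuousOn fun u hu ↦ hcmem hu
  have hη0 : (η 0).im = 0 := by
    have h := hext c (u := 0) ⟨le_rfl, zero_lt_one⟩
    simp only [hη]
    rw [h]
    change (ψ (c 0)).im = 0
    rw [h0, hψa, Complex.zero_im]
  -- the approximants
  have hcnmem : ∀ n {u : ℝ} (hu : u ∈ Ico (0 : ℝ) 1),
      IccExtend zero_le_one (cn n) u ∈ closure D.carrier \ {D.pt 1} := by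
    intro n u hu
    rw [hext (cn n) hu]
    rcases hu.1.eq_or_lt with h00 | h00
    · have : (⟨u, hu.1, hu.2.le⟩ : I) = 0 := Subtype.ext h00.symm
      rw [this, h0n n]
      refine ⟨frontier_subset_closure (D.pt_mem_frontier 0), fun h ↦ ?_⟩
      rw [mem_singleton_iff] at h
      exact D.pt_injective.ne (by decide) h
    · exact ⟨subset_closure (hinn n _ h00 hu.2), fun h ↦ by
        rw [mem_singleton_iff] at h
        exact D.pt_notMem_carrier 1 (h ▸ hinn n _ h00 hu.2)⟩
  have hηn_nonneg : ∀ n, ∀ u ∈ Ico (0 : ℝ) 1, 0 ≤ (ηn n u).im := fun n u hu ↦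
    (hψΦ _ (hcnmem n hu)).1
  have hηn_eq : ∀ n, ∀ u (hu : u ∈ Ioo (0 : ℝ) 1),
      ηn n u = φ.symm (cn n ⟨u, hu.1.le, hu.2.le⟩) := by
    intro n u hu
    simp only [hηn]
    rw [hext (cn n) ⟨hu.1.le, hu.2⟩]
    exact hψsymm _ (hinn n _ hu.1 hu.2)
  have hηn0 : ∀ n, ηn n 0 = 0 := fun n ↦ by
    simp only [hηn]
    rw [hext (cn n) (u := 0) ⟨le_rfl, zero_lt_one⟩]
    change ψ (cn n 0) = 0
    rw [h0n n, hψa]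
  -- the capacity parametrisations of the approximants
  have hdata : ∀ n, ∃ (Wn : ℝ≥0 → ℝ) (θn : ℝ → ℝ≥0),
      IsLoewnerDescribed φ (CurveClass.mk (cn n)) Wn ∧ Wn 0 = 0 ∧
        ContinuousOn θn (Ico 0 1) ∧ StrictMonoOn θn (Ico 0 1) ∧ θn 0 = 0 ∧
        Tendsto θn (𝓝[<] 1) atTop ∧
        ∀ u (hu : u ∈ Ioo (0 : ℝ) 1),
          Loewner.trace Wn (θn u) = φ.symm (cn n ⟨u, hu.1.le, hu.2.le⟩) :=
    fun n ↦ hφ.exists_isLoewnerDescribed_of_injOn (h0n n) (h1n n) (hinn n) (hinjn n) (hinfn n)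
  choose Wn θn hdesc hWn0 hθc hθm hθ0 hθinf htrace using hdata
  have hWn_eq : ∀ n, drivingFunction φ (CurveClass.mk (cn n)) = Wn n := fun n ↦
    (hdesc n).drivingFunction_eq IsLoewnerDescribed.driving_unique_holds hφ
  have hgen : ∀ n, Loewner.IsGeneratedByCurve (Wn n) (Loewner.trace (Wn n)) := fun n ↦ by
    obtain ⟨-, γ, hγ, -⟩ := hdesc n
    exact Loewner.isGeneratedByCurve_trace ⟨γ, hγ⟩
  have hγθ : ∀ n, ∀ u ∈ Ico (0 : ℝ) 1, Loewner.trace (Wn n) (θn n u) = ηn n u := by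
    intro n u hu
    rcases hu.1.eq_or_lt with h00 | h00
    · rw [← h00, hθ0 n, Loewner.trace_zero, hWn0 n, hηn0 n, Complex.ofReal_zero]
    · rw [htrace n u ⟨h00, hu.2⟩, hηn_eq n u ⟨h00, hu.2⟩]
  -- uniform convergence of the pull-backs on `[0, s]`
  have hlimη : ∀ s, s < 1 → TendstoUniformlyOn ηn η atTop (Icc 0 s) := by
    intro s hs
    refine tendstoUniformlyOn_pullback hψc hlim (fun n t ↦ ?_) (fun t ↦ ?_) (s₀ := s) ?_
    · rcases lt_or_ge (t : ℝ) 1 with ht | ht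
      · have := hcnmem n (u := t) ⟨t.2.1, ht⟩
        rw [IccExtend_of_mem zero_le_one _ t.2] at this
        exact this.1
      · have : t = 1 := Subtype.ext (le_antisymm t.2.2 ht)
        rw [this, h1n n]
        exact frontier_subset_closure (D.pt_mem_frontier 1)
    · rcases lt_or_ge (t : ℝ) 1 with ht | ht
      · exact (hcl t ht).1
      · have : t = 1 := Subtype.ext (le_antisymm t.2.2 ht)
        rw [this]
        have h1 : c 1 = D.pt 1 := by
          -- `c 1` is the limit of `c_n 1 = b`
          have hl : Tendsto (fun n ↦ cn n 1) atTop (𝓝 (c 1)) := hlim.tendsto_at 1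
          simp only [h1n] at hl
          exact (tendsto_const_nhds_iff.1 hl).symm
        rw [h1]
        exact frontier_subset_closure (D.pt_mem_frontier 1)
    · intro t hts
      exact (hcl t (hts.trans_lt hs)).2
  refine ⟨η, ηn, θn, hηchar, hηc, hη0, hηn_nonneg, hlimη, hθc, hθm, hθ0, hθinf, fun n u hu ↦ ?_,
    fun n ↦ ?_, fun n ↦ ?_⟩
  · rw [hWn_eq n]; exact hγθ n u hu
  · rw [hWn_eq n]; exact (hdesc n).continuous
  · rw [hWn_eq n]; exact hgen n

/-- **Kemppainen–Smirnov's main lemma in a Dobrushin domain.** Let `φ` be a chordal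
uniformizing map of `(D; a, b)` with boundary extension `Φ`, and let `c_n : [0, 1] → ℂ` be
simple chordal curves of `(D; a, b)` — `c_n 0 = a`, `c_n 1 = b`, `c_n(0, 1) ⊆ D`, injective on
`(0, 1)`, entering `b` with diverging capacity (`im φ⁻¹(c_n u) → ∞`) — whose Loewner transforms
`W_n = drivingFunction φ ⟦c_n⟧` converge locally uniformly to a continuous `W`. Let `c_n → c`
uniformly as parametrised curves, where `c 0 = a`, `c 1 = b` and `c[0, 1) ⊆ closure D ∖ {b}`
(the limit may touch `∂D`). Suppose finally that the pull-back `η` of `c` to `ℍ̄` (the curve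
with `im η ≥ 0` and `Φ ∘ η = c` on `[0, 1)`) keeps leaving its past hull and has capacity
tending to `∞` (the hypotheses `hgrow`, `hdiv` of `exists_capacity_parametrisation_of_limit`,
required of every such `η`). Then the class of `c` is described through `φ` by `W`
(`IsLoewnerDescribed φ ⟦c⟧ W`) with `W 0 = 0`; moreover the capacity parametrisations converge:
there are the limit clock `θ` and a curve `γ` generating the chain of `W` with
`Φ (γ (θ u)) = c u`, and the traces of the chains of the `W_n` tend to `γ` locally uniformly.
(KS Lemma A.4 with Lemma A.2, `LoewnerCurveLimit.lean`, `HullHausdorffCapacity.lean`; the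
describability of the simple approximants, `exists_isLoewnerDescribed_of_injOn`; the packaging
`isLoewnerDescribed_of_capacity_parametrisation'`.) [cite: KemppainenSmirnov2017, App. A Lemma A.4]
[cite: CDHKSCRAS2014, Thm. 3] -/
theorem exists_isLoewnerDescribed_of_limit (hφ : D.IsChordalUniformizing φ)
    {cn : ℕ → Curve ℂ} {c : Curve ℂ} {W : ℝ≥0 → ℝ}
    (h0n : ∀ n, cn n 0 = D.pt 0) (h1n : ∀ n, cn n 1 = D.pt 1)
    (hinn : ∀ n (s : I), 0 < (s : ℝ) → (s : ℝ) < 1 → cn n s ∈ D.carrier)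
    (hinjn : ∀ n, InjOn (cn n) {s : I | 0 < (s : ℝ) ∧ (s : ℝ) < 1})
    (hinfn : ∀ n, Tendsto (fun u : ℝ ↦ (φ.symm (IccExtend zero_le_one (cn n) u)).im)
      (𝓝[<] 1) atTop)
    (h0 : c 0 = D.pt 0) (h1 : c 1 = D.pt 1)
    (hcl : ∀ s : I, (s : ℝ) < 1 → c s ∈ closure D.carrier ∧ c s ≠ D.pt 1)
    (hlim : TendstoUniformly (fun n (s : I) ↦ cn n s) c atTop)
    (hgrow : ∀ η : ℝ → ℂ,
      (∀ u ∈ Ico (0 : ℝ) 1, 0 ≤ (η u).im ∧ φ.boundaryExtension (η u) = IccExtend zero_le_one c u) →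
      ∀ s s', 0 ≤ s → s < s' → s' < 1 →
        ∃ u ∈ Ioc s s', η u ∈ upperHalfPlaneSet \ hpFill (η '' Icc 0 s))
    (hdiv : ∀ η : ℝ → ℂ,
      (∀ u ∈ Ico (0 : ℝ) 1, 0 ≤ (η u).im ∧ φ.boundaryExtension (η u) = IccExtend zero_le_one c u) →
      ∀ M : ℝ, ∃ s ∈ Ico (0 : ℝ) 1,
        ∀ ψ' : ConformalEquiv (upperHalfPlaneSet \ hpFill (η '' Icc 0 s)) upperHalfPlaneSet,
          IsHydrodynamicMap (hpFill (η '' Icc 0 s)) ψ' → M ≤ hcap (hpFill (η '' Icc 0 s)) ψ')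
    (hW : Continuous W)
    (hWlim : TendstoLocallyUniformly (fun n ↦ drivingFunction φ (CurveClass.mk (cn n))) W atTop) :
    IsLoewnerDescribed φ (CurveClass.mk c) W ∧ W 0 = 0 ∧
      ∃ (θ : ℝ → ℝ≥0) (γ : ℝ≥0 → ℂ), ContinuousOn θ (Ico 0 1) ∧ StrictMonoOn θ (Ico 0 1) ∧
        θ 0 = 0 ∧ Tendsto θ (𝓝[<] 1) atTop ∧ Continuous γ ∧ Loewner.IsGeneratedByCurve W γ ∧
        (∀ u (hu : u ∈ Ioo (0 : ℝ) 1), φ.boundaryExtension (γ (θ u)) = c ⟨u, hu.1.le, hu.2.le⟩) ∧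
        TendstoLocallyUniformly (fun n ↦ Loewner.trace (drivingFunction φ (CurveClass.mk (cn n))))
          γ atTop := by
  obtain ⟨η, ηn, θn, hηchar, hηc, hη0, -, hlimη, hθc, hθm, hθ0, hθinf, hγθ, hWnc, hgen⟩ :=
    hφ.exists_limit_pullback_data h0n h1n hinn hinjn hinfn h0 hcl hlim
  obtain ⟨θ, γ, hθcont, hθstrict, hθzero, hθdiv, hγθ', hγc, hgenW, hγlim, -⟩ :=
    exists_capacity_parametrisation_of_limit hθc hθm hθ0 hθinf hγθ hWnc hgen hη0 hηc hlimη
      (hgrow η hηchar) (hdiv η hηchar) hW hWlim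
  have hext : ∀ {u : ℝ} (hu : u ∈ Ico (0 : ℝ) 1), IccExtend zero_le_one c u = c ⟨u, hu.1, hu.2.le⟩ :=
    fun hu ↦ IccExtend_of_mem zero_le_one c ⟨hu.1, hu.2.le⟩
  have hγ0 : γ 0 = 0 := by
    have h := hγθ' 0 ⟨le_rfl, zero_lt_one⟩
    rw [hθzero] at h
    -- `η 0` is the point of `ℍ̄` over `c 0 = a`, i.e. `0`
    have hη00 : η 0 = 0 := by
      have hchar := hηchar 0 ⟨le_rfl, zero_lt_one⟩
      have him : (η 0).im = 0 := hη0
      have hreal : η 0 = (((η 0).re : ℝ) : ℂ) := Complex.ext (by simp) (by simp [him])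
      have hΦ := hchar.2
      rw [hext ⟨le_rfl, zero_lt_one⟩] at hΦ
      change φ.boundaryExtension (η 0) = c 0 at hΦ
      rw [h0] at hΦ
      -- `Φ x = a` for real `x` forces `x = 0` (injectivity of `Φ` on `ℍ̄`, `Φ 0 = a`)
      have ha : φ.boundaryExtension 0 = D.pt 0 :=
        φ.boundaryExtension_eq_of_hasBoundaryValue (mem_closure_upperHalfPlaneSet_iff.2 (by simp)) hφ.1
      have hinj := JordanDomain.injOn_boundaryExtension φ (show (η 0) ∈ {z : ℂ | 0 ≤ z.im} from hchar.1)
        (show (0 : ℂ) ∈ {z : ℂ | 0 ≤ z.im} by simp) (hΦ.trans ha.symm)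
      exact hinj
    rw [h, hη00]
  have hΦγ : ∀ u (hu : u ∈ Ioo (0 : ℝ) 1),
      φ.boundaryExtension (γ (θ u)) = c ⟨u, hu.1.le, hu.2.le⟩ := by
    intro u hu
    have huI : u ∈ Ico (0 : ℝ) 1 := ⟨hu.1.le, hu.2⟩
    rw [hγθ' u huI, (hηchar u huI).2, hext huI]
  have hdescW : IsLoewnerDescribed φ (CurveClass.mk c) W :=
    hφ.isLoewnerDescribed_of_capacity_parametrisation' h0 h1 hθcont hθstrict hθzero hθdiv hW
      hgenW hγ0 hΦγ
  have hW0 : W 0 = 0 := apply_zero_eq_zero_of_isGeneratedByCurve hgenW hγ0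
  exact ⟨hdescW, hW0, θ, γ, hθcont, hθstrict, hθzero, hθdiv, hγc, hgenW, hΦγ, hγlim⟩

/-- **Kemppainen–Smirnov's main lemma in a Dobrushin domain, divergence read off the pull-back's
height**: the same as `exists_isLoewnerDescribed_of_limit` with the hypothesis "the capacity of
the pull-back tends to `∞`" replaced by "`im η` is unbounded on `[0, 1)`" (for the pull-backs
lie in `ℍ̄`, `exists_capacity_parametrisation_of_limit_of_im`), e.g. when `c` approaches `b`
inside a Stolz sector of `φ`. [cite: KemppainenSmirnov2017, App. A Lemma A.4] -/
theorem exists_isLoewnerDescribed_of_limit_of_im (hφ : D.IsChordalUniformizing φ)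
    {cn : ℕ → Curve ℂ} {c : Curve ℂ} {W : ℝ≥0 → ℝ}
    (h0n : ∀ n, cn n 0 = D.pt 0) (h1n : ∀ n, cn n 1 = D.pt 1)
    (hinn : ∀ n (s : I), 0 < (s : ℝ) → (s : ℝ) < 1 → cn n s ∈ D.carrier)
    (hinjn : ∀ n, InjOn (cn n) {s : I | 0 < (s : ℝ) ∧ (s : ℝ) < 1})
    (hinfn : ∀ n, Tendsto (fun u : ℝ ↦ (φ.symm (IccExtend zero_le_one (cn n) u)).im)
      (𝓝[<] 1) atTop)
    (h0 : c 0 = D.pt 0) (h1 : c 1 = D.pt 1)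
    (hcl : ∀ s : I, (s : ℝ) < 1 → c s ∈ closure D.carrier ∧ c s ≠ D.pt 1)
    (hlim : TendstoUniformly (fun n (s : I) ↦ cn n s) c atTop)
    (hgrow : ∀ η : ℝ → ℂ,
      (∀ u ∈ Ico (0 : ℝ) 1, 0 ≤ (η u).im ∧ φ.boundaryExtension (η u) = IccExtend zero_le_one c u) →
      ∀ s s', 0 ≤ s → s < s' → s' < 1 →
        ∃ u ∈ Ioc s s', η u ∈ upperHalfPlaneSet \ hpFill (η '' Icc 0 s))
    (hdivIm : ∀ η : ℝ → ℂ,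
      (∀ u ∈ Ico (0 : ℝ) 1, 0 ≤ (η u).im ∧ φ.boundaryExtension (η u) = IccExtend zero_le_one c u) →
      ∀ M : ℝ, ∃ s ∈ Ico (0 : ℝ) 1, M ≤ (η s).im)
    (hW : Continuous W)
    (hWlim : TendstoLocallyUniformly (fun n ↦ drivingFunction φ (CurveClass.mk (cn n))) W atTop) :
    IsLoewnerDescribed φ (CurveClass.mk c) W ∧ W 0 = 0 ∧
      ∃ (θ : ℝ → ℝ≥0) (γ : ℝ≥0 → ℂ), ContinuousOn θ (Ico 0 1) ∧ StrictMonoOn θ (Ico 0 1) ∧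
        θ 0 = 0 ∧ Tendsto θ (𝓝[<] 1) atTop ∧ Continuous γ ∧ Loewner.IsGeneratedByCurve W γ ∧
        (∀ u (hu : u ∈ Ioo (0 : ℝ) 1), φ.boundaryExtension (γ (θ u)) = c ⟨u, hu.1.le, hu.2.le⟩) ∧
        TendstoLocallyUniformly (fun n ↦ Loewner.trace (drivingFunction φ (CurveClass.mk (cn n))))
          γ atTop := by
  obtain ⟨η, ηn, θn, hηchar, hηc, hη0, hηn_nonneg, hlimη, hθc, hθm, hθ0, hθinf, hγθ, hWnc, hgen⟩ :=
    hφ.exists_limit_pullback_data h0n h1n hinn hinjn hinfn h0 hcl hlim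
  obtain ⟨θ, γ, hθcont, hθstrict, hθzero, hθdiv, hγθ', hγc, hgenW, hγlim, -⟩ :=
    exists_capacity_parametrisation_of_limit_of_im hθc hθm hθ0 hθinf hγθ hWnc hgen hηn_nonneg hη0
      hηc hlimη (hgrow η hηchar) (hdivIm η hηchar) hW hWlim
  have hext : ∀ {u : ℝ} (hu : u ∈ Ico (0 : ℝ) 1), IccExtend zero_le_one c u = c ⟨u, hu.1, hu.2.le⟩ :=
    fun hu ↦ IccExtend_of_mem zero_le_one c ⟨hu.1, hu.2.le⟩
  have hγ0 : γ 0 = 0 := by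
    have h := hγθ' 0 ⟨le_rfl, zero_lt_one⟩
    rw [hθzero] at h
    have hη00 : η 0 = 0 := by
      have hchar := hηchar 0 ⟨le_rfl, zero_lt_one⟩
      have hΦ := hchar.2
      rw [hext ⟨le_rfl, zero_lt_one⟩] at hΦ
      change φ.boundaryExtension (η 0) = c 0 at hΦ
      rw [h0] at hΦ
      have ha : φ.boundaryExtension 0 = D.pt 0 :=
        φ.boundaryExtension_eq_of_hasBoundaryValue (mem_closure_upperHalfPlaneSet_iff.2 (by simp)) hφ.1
      exact JordanDomain.injOn_boundaryExtension φ (show (η 0) ∈ {z : ℂ | 0 ≤ z.im} from hchar.1)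
        (show (0 : ℂ) ∈ {z : ℂ | 0 ≤ z.im} by simp) (hΦ.trans ha.symm)
    rw [h, hη00]
  have hΦγ : ∀ u (hu : u ∈ Ioo (0 : ℝ) 1),
      φ.boundaryExtension (γ (θ u)) = c ⟨u, hu.1.le, hu.2.le⟩ := by
    intro u hu
    have huI : u ∈ Ico (0 : ℝ) 1 := ⟨hu.1.le, hu.2⟩
    rw [hγθ' u huI, (hηchar u huI).2, hext huI]
  have hdescW : IsLoewnerDescribed φ (CurveClass.mk c) W :=
    hφ.isLoewnerDescribed_of_capacity_parametrisation' h0 h1 hθcont hθstrict hθzero hθdiv hW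
      hgenW hγ0 hΦγ
  have hW0 : W 0 = 0 := apply_zero_eq_zero_of_isGeneratedByCurve hgenW hγ0
  exact ⟨hdescW, hW0, θ, γ, hθcont, hθstrict, hθzero, hθdiv, hγc, hgenW, hΦγ, hγlim⟩

/-! ### From convergent curve classes to uniformly convergent representatives -/

/-- **Convergence of curve classes gives uniformly convergent reparametrised representatives**:
if `⟦c_n⟧ → ⟦c⟧` in the space of curves modulo reparametrisation (Aizenman–Burchard metric),
there are increasing homeomorphisms `ρ_n` of `[0, 1]` with `c_n ∘ ρ_n → c` uniformly.
[folklore] -/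
theorem exists_reparam_tendstoUniformly {cn : ℕ → Curve ℂ} {c : Curve ℂ}
    (hlim : Tendsto (fun n ↦ CurveClass.mk (cn n)) atTop (𝓝 (CurveClass.mk c))) :
    ∃ ρ : ℕ → (I ≃o I), TendstoUniformly (fun n (s : I) ↦ (cn n).reparam (ρ n) s) c atTop := by
  have hd : Tendsto (fun n ↦ dist c (cn n)) atTop (𝓝 0) := by
    have h := tendsto_iff_dist_tendsto_zero.1 hlim
    refine h.congr fun n ↦ ?_
    rw [CurveClass.dist_mk_mk, dist_comm]
  -- near-optimal reparametrisations
  have hex : ∀ n : ℕ, ∃ ρ : I ≃o I,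
      dist c.toContinuousMap ((cn n).reparam ρ).toContinuousMap < dist c (cn n) + 1 / ((n : ℝ) + 1) := by
    intro n
    have h : Curve.reparamDist c (cn n) < dist c (cn n) + 1 / ((n : ℝ) + 1) := by
      rw [Curve.dist_def]
      linarith [show (0 : ℝ) < 1 / ((n : ℝ) + 1) by positivity]
    exact exists_lt_of_ciInf_lt h
  choose ρ hρ using hex
  refine ⟨ρ, ?_⟩
  rw [Metric.tendstoUniformly_iff]
  intro ε hε
  have h1 : Tendsto (fun n : ℕ ↦ dist c (cn n) + 1 / ((n : ℝ) + 1)) atTop (𝓝 0) := by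
    simpa using hd.add tendsto_one_div_add_atTop_nhds_zero_nat
  filter_upwards [(tendsto_order.1 h1).2 ε hε] with n hn s
  exact (ContinuousMap.dist_apply_le_dist s).trans_lt ((hρ n).trans hn)

/-- **Kemppainen–Smirnov's main lemma in a Dobrushin domain, for convergent curve classes**:
the hypotheses and conclusion of `exists_isLoewnerDescribed_of_limit` with the uniform
convergence of the parametrised curves replaced by the convergence `⟦c_n⟧ → ⟦c⟧` of their
classes (the topology in which laws of random curves converge; Aizenman–Burchard,
Kemppainen–Smirnov Thm. 1.5): the approximants are reparametrised by
`exists_reparam_tendstoUniformly`, which changes neither their classes nor their Loewner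
transforms. [cite: KemppainenSmirnov2017, Thm. 1.5 and App. A Lemma A.4] [cite: CDHKSCRAS2014, Thm. 3] -/
theorem exists_isLoewnerDescribed_of_tendsto_mk (hφ : D.IsChordalUniformizing φ)
    {cn : ℕ → Curve ℂ} {c : Curve ℂ} {W : ℝ≥0 → ℝ}
    (h0n : ∀ n, cn n 0 = D.pt 0) (h1n : ∀ n, cn n 1 = D.pt 1)
    (hinn : ∀ n (s : I), 0 < (s : ℝ) → (s : ℝ) < 1 → cn n s ∈ D.carrier)
    (hinjn : ∀ n, InjOn (cn n) {s : I | 0 < (s : ℝ) ∧ (s : ℝ) < 1})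
    (hinfn : ∀ n, Tendsto (fun u : ℝ ↦ (φ.symm (IccExtend zero_le_one (cn n) u)).im)
      (𝓝[<] 1) atTop)
    (h0 : c 0 = D.pt 0) (h1 : c 1 = D.pt 1)
    (hcl : ∀ s : I, (s : ℝ) < 1 → c s ∈ closure D.carrier ∧ c s ≠ D.pt 1)
    (hlim : Tendsto (fun n ↦ CurveClass.mk (cn n)) atTop (𝓝 (CurveClass.mk c)))
    (hgrow : ∀ η : ℝ → ℂ,
      (∀ u ∈ Ico (0 : ℝ) 1, 0 ≤ (η u).im ∧ φ.boundaryExtension (η u) = IccExtend zero_le_one c u) →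
      ∀ s s', 0 ≤ s → s < s' → s' < 1 →
        ∃ u ∈ Ioc s s', η u ∈ upperHalfPlaneSet \ hpFill (η '' Icc 0 s))
    (hdiv : ∀ η : ℝ → ℂ,
      (∀ u ∈ Ico (0 : ℝ) 1, 0 ≤ (η u).im ∧ φ.boundaryExtension (η u) = IccExtend zero_le_one c u) →
      ∀ M : ℝ, ∃ s ∈ Ico (0 : ℝ) 1,
        ∀ ψ' : ConformalEquiv (upperHalfPlaneSet \ hpFill (η '' Icc 0 s)) upperHalfPlaneSet,
          IsHydrodynamicMap (hpFill (η '' Icc 0 s)) ψ' → M ≤ hcap (hpFill (η '' Icc 0 s)) ψ')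
    (hW : Continuous W)
    (hWlim : TendstoLocallyUniformly (fun n ↦ drivingFunction φ (CurveClass.mk (cn n))) W atTop) :
    IsLoewnerDescribed φ (CurveClass.mk c) W ∧ W 0 = 0 := by
  obtain ⟨ρ, hρ⟩ := exists_reparam_tendstoUniformly hlim
  set cn' : ℕ → Curve ℂ := fun n ↦ (cn n).reparam (ρ n) with hcn'
  have happ : ∀ n (s : I), cn' n s = cn n (ρ n s) := fun n s ↦ rfl
  -- the reparametrisations preserve the interior of the parameter interval
  have hρ0 : ∀ n, ρ n 0 = 0 := fun n ↦ (ρ n).map_bot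
  have hρ1 : ∀ n, ρ n 1 = 1 := fun n ↦ (ρ n).map_top
  have hρmem : ∀ n (s : I), 0 < (s : ℝ) → (s : ℝ) < 1 →
      0 < ((ρ n s : I) : ℝ) ∧ ((ρ n s : I) : ℝ) < 1 := by
    intro n s hs0 hs1
    have h0' : (0 : I) < s := Subtype.coe_lt_coe.1 (by simpa using hs0)
    have h1' : s < (1 : I) := Subtype.coe_lt_coe.1 (by simpa using hs1)
    have h0'' := (ρ n).strictMono h0'
    have h1'' := (ρ n).strictMono h1'
    rw [hρ0 n] at h0''
    rw [hρ1 n] at h1''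
    exact ⟨by simpa using (Subtype.coe_lt_coe.2 h0''), by simpa using (Subtype.coe_lt_coe.2 h1'')⟩
  -- transfer of the hypotheses on the approximants
  have h0n' : ∀ n, cn' n 0 = D.pt 0 := fun n ↦ by rw [happ, hρ0 n, h0n n]
  have h1n' : ∀ n, cn' n 1 = D.pt 1 := fun n ↦ by rw [happ, hρ1 n, h1n n]
  have hinn' : ∀ n (s : I), 0 < (s : ℝ) → (s : ℝ) < 1 → cn' n s ∈ D.carrier := fun n s hs0 hs1 ↦ by
    rw [happ]
    exact hinn n _ (hρmem n s hs0 hs1).1 (hρmem n s hs0 hs1).2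
  have hinjn' : ∀ n, InjOn (cn' n) {s : I | 0 < (s : ℝ) ∧ (s : ℝ) < 1} := by
    intro n s hs s' hs' heq
    rw [happ, happ] at heq
    have h := hinjn n (hρmem n s hs.1 hs.2) (hρmem n s' hs'.1 hs'.2) heq
    exact (ρ n).injective h
  have hinfn' : ∀ n, Tendsto (fun u : ℝ ↦ (φ.symm (IccExtend zero_le_one (cn' n) u)).im)
      (𝓝[<] 1) atTop := by
    intro n
    set g : ℝ → ℝ := fun u ↦ ((ρ n (projIcc (0 : ℝ) 1 zero_le_one u) : I) : ℝ) with hg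
    have hgmem : ∀ u, g u ∈ Icc (0 : ℝ) 1 := fun u ↦ (ρ n (projIcc (0 : ℝ) 1 zero_le_one u)).2
    have heq : ∀ u, IccExtend zero_le_one (cn' n) u = IccExtend zero_le_one (cn n) (g u) := by
      intro u
      rw [IccExtend_of_mem zero_le_one (cn n) (hgmem u)]
      rfl
    have hgc : Continuous g :=
      continuous_subtype_val.comp ((ρ n).toHomeomorph.continuous.comp continuous_projIcc)
    have hg1 : g 1 = 1 := by
      have hp1 : (projIcc (0 : ℝ) 1 zero_le_one 1 : I) = 1 :=
        Subtype.ext (by rw [coe_projIcc]; simp)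
      simp only [hg]
      rw [hp1, hρ1 n]
      simp
    have hglt : ∀ u, u < 1 → g u < 1 := by
      intro u hu
      have hp : (projIcc (0 : ℝ) 1 zero_le_one u : I) < 1 := by
        refine Subtype.coe_lt_coe.1 ?_
        rw [coe_projIcc]
        simp only [Icc.coe_one]
        exact max_lt (by norm_num) (min_lt_of_right_lt hu)
      have := (ρ n).strictMono hp
      rw [hρ1 n] at this
      simpa [hg] using (Subtype.coe_lt_coe.2 this)
    have hgt : Tendsto g (𝓝[<] 1) (𝓝[<] 1) := by
      refine tendsto_nhdsWithin_of_tendsto_nhds_of_eventually_within _ ?_ ?_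
      · have := hgc.tendsto 1
        rw [hg1] at this
        exact this.mono_left nhdsWithin_le_nhds
      · filter_upwards [self_mem_nhdsWithin] with u hu using hglt u hu
    exact ((hinfn n).comp hgt).congr fun u ↦ by simp only [comp_apply, heq]
  have hmk : ∀ n, CurveClass.mk (cn' n) = CurveClass.mk (cn n) := fun n ↦
    CurveClass.mk_reparam (cn n) (ρ n)
  have hWlim' : TendstoLocallyUniformly (fun n ↦ drivingFunction φ (CurveClass.mk (cn' n))) W atTop := by
    simp only [hmk]
    exact hWlim
  obtain ⟨hdesc, hW0, -⟩ := hφ.exists_isLoewnerDescribed_of_limit h0n' h1n' hinn' hinjn' hinfn'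
    h0 h1 hcl hρ hgrow hdiv hW hWlim'
  exact ⟨hdesc, hW0⟩

end MarkedDomain.IsChordalUniformizing

end Literature.Probability.RandomPlanarGeometry
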